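import Summits.AtomisticToContinuum.Crystallization.Theorems.FrustratedLawDichotomyStrainedPatchHomEntryLeafHTA2QCellG77SV2

/-!
# v3 T0 CELL `cG77S × wG77S` (0.775 t_b, SEVEN-coarse: 2⁻¹⁰ on (0,0),(1,1), 2⁻⁹ else (k₆ = 4)), part 3: far sum, FOUR inner hull leaves (ξ₀, ξ₁ split once each), END TO END in the v3 currency
# (27623 `(H) HomFloor (1/625)`, hcp half; hand-1 g38; T0 cell under critic row 1437 (E) «T0 ≤ 500 core-h RELEASED (anchors + ≤ 40 cells)»; payloads from hand-1 g37 probes `G77P7` a/b/c + hand-1 g38 probe `M38` (kernel-exact `rem3LJS`))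

Kernel facts + assembly; 0 sorry; standard axioms.  `--supports stmt-AtomisticToContinuum-27623`.
-/

namespace Summit.AtomisticToContinuum.Crystallization.Theorems.FrustratedLawDichotomyStrainedPatchHomEntryLeafHT

open Literature.Analysis.ValidatedNumerics.Numerics
open Summit.AtomisticToContinuum.Crystallization.Theorems.FrustratedLawDichotomyStrainedPatchHomCertTree (CertTree treeOK)
open Summit.AtomisticToContinuum.Crystallization.Theorems.FrustratedLawDichotomyStrainedPatchHomEntryTable (muRec)
open Summit.AtomisticToContinuum.Crystallization.Theorems.FrustratedLawDichotomyStrainedPatchHomEntryFitHcpCentred (entryLeafOKHQDCRS)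
open Summit.AtomisticToContinuum.Crystallization.Theorems.FrustratedLawDichotomyStrainedPatchHomSlopeLJ
open Summit.AtomisticToContinuum.Crystallization.Theorems.FrustratedLawDichotomyStrainedPatchHomSlopeLJAffine
open Summit.AtomisticToContinuum.Crystallization.Theorems.FrustratedLawDichotomyStrainedPatchHomSlopeLJAffine2Kit
open Summit.AtomisticToContinuum.Crystallization.Theorems.FrustratedLawDichotomyStrainedPatchHomSlopeLJAffine2KitS (rem3LJS)

/-- Inner tree: split ξ₀ once, then ξ₁ once (4 leaves). -/
def t4_G77S : CertTree ((Fin 3 × Fin 3) ⊕ Fin 3) :=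
  .split (Sum.inr 0) (.split (Sum.inr 1) .leaf .leaf) (.split (Sum.inr 1) .leaf .leaf)

set_option maxRecDepth 100000 in
set_option maxHeartbeats 4000000 in
/-- ★ KERNEL: `GnG77SV + far₁ + far₂ ≤ pG77SV.Gs`. -/
theorem farG77SV : GnG77SV + htGsNA cG77S wG77S JG77S (htFar1U cG77S wG77S) + htGsNA cG77S wG77S JG77S (htFar2U cG77S wG77S) ≤ pG77SV.Gs := by
  decide +kernel

/-- ★★★ The sharp-remainder certificate side of the cell holds. [assembly] -/
theorem htCertSideA2QS_G77SV : htCertSideA2QS pG77SV QG77S GnG77SV JG77S cG77S wG77S = true :=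
  htCertSideA2QS_of_parts restG77SV qG77S_0 qG77S_1 qG77S_2 linG77SV farG77SV

set_option maxRecDepth 100000 in
set_option maxHeartbeats 4000000 in
/-- ★ KERNEL: FOUR inner hull leaves (ξ₀, ξ₁ split once each) of the squared-test inner verdict close the confined box `htWr pG77SV`. -/
theorem treeA2QS_G77SV : treeOK (hullInner (entryLeafOKHQDCRS muRec qX90c) JG77S cG77S) t4_G77S cG77S (htWr pG77SV cG77S wG77S) = true := by
  decide +kernel

/-- ★★★ **THE CELL CLOSES END TO END IN THE v3 CURRENCY.** [assembly] -/
theorem entryLeafOKHT4A2QSQDCRS_G77SV : entryLeafOKHT4A2QSQDCRS muRec qX90c pG77SV QG77S GnG77SV JG77S t4_G77S cG77S wG77S = true :=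
  entryLeafOKHT4A2QSQDCRS_of_parts htCertSideA2QS_G77SV treeA2QS_G77SV

/-- ★ … hence the cell is a one-leaf ∃-tree of the production verdict v3 `entryLeafOKHT4A2QQDCRS3 muRec`. [formal bookkeeping] -/
theorem okS3_G77S : ∃ t : CertTree ((Fin 3 × Fin 3) ⊕ Fin 3), treeOK (entryLeafOKHT4A2QQDCRS3 muRec) t cG77S wG77S = true :=
  exists_tree_HT4A2QQDCRS3_of_certS3 entryLeafOKHT4A2QSQDCRS_G77SV

end Summit.AtomisticToContinuum.Crystallization.Theorems.FrustratedLawDichotomyStrainedPatchHomEntryLeafHT
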